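import Literature.Computability.Complexity.MatchingSymmetry
import Literature.Computability.Complexity.MatchingLevelSums
import HarnessLib

/-!
# BBCHPRRWZ Lemma 4.7: symmetrized polynomials are congruent to constants

Braun–Brown-Cohen–Huq–Pokutta–Raghavendra–Roy–Weitz–Zink, *The matching problem has no small
symmetric SDP*, Math. Program. 165 (2017), Lemma 4.7: "For any polynomial `F`, there is a constant
`c_F` with `Σ_{σ ∈ S_n} σF ≅_{(𝒫_n, deg F)} c_F`."  Proof (verbatim): "Given Lemma 4.4, it suffices
to prove the claim for `F = x_M` for some partial matching `M` … `Σ_σ σ x_M = 2^k k!(n-2k)! Σ_{|M'|=k} x_{M'}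
≅_k 2^k k!(n-2k)! (n/2 choose k)`" (Lemma 4.6 with `d = 0`).

Here: the `S_n`-orbit sum of a matching monomial is a multiple of the level sum `T_k`
(`sum_polyPerm_xM`, via TRANSITIVITY of `S_n` on `k`-matchings, `exists_perm_mapEdges_eq`, and
constancy of the fibre counts on an orbit — the constant `2^k k!(n-2k)!` is not computed), the
level sums are congruent to constants (`levelSum_isCong_C`, `MatchingLevelSums.lean`), and Lemma 4.4
in explicit form (`isCong_normalForm`). Result: `symmetrizationConstant`, the cell's typed
`SymmetrizationConstant` (HOME/pnp-psdrank-p2/Sketch-v2.lean §2c; its hypothesis `Even n` is not needed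
and is kept only to match the typed statement in `symmetrizationConstant'`).

## References

* G. Braun et al., *The matching problem has no small symmetric SDP*, Math. Program. 165 (2017)
  643–662, Lemma 4.7 (arXiv:1504.00703, p. 8). [BraunEtAl2016]
-/

noncomputable section

open MvPolynomial Finset

namespace Literature.Computability.Complexity

namespace Mod2

variable {n : ℕ}

/-! ### The action on edge sets -/

/-- `σ • M` on edge sets of `K_n`. [cite: BraunEtAl2016, §4.1 (p. 7, "σ · M")] -/
def mapEdges (σ : Equiv.Perm (Fin n)) (M : Finset (KnEdge n)) : Finset (KnEdge n) :=
  M.map ⟨edgeMap σ σ.injective, edgeMap_injective _ _⟩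

/-- Membership. [cite: BraunEtAl2016, §4.1 (p. 7)] -/
theorem mem_mapEdges {σ : Equiv.Perm (Fin n)} {M : Finset (KnEdge n)} {e : KnEdge n} :
    e ∈ mapEdges σ M ↔ ∃ f ∈ M, edgeMap σ σ.injective f = e := by
  simp [mapEdges]

/-- Cardinality is preserved. [cite: BraunEtAl2016, §4.1 (p. 7)] -/
theorem card_mapEdges (σ : Equiv.Perm (Fin n)) (M : Finset (KnEdge n)) : (mapEdges σ M).card = M.card :=
  card_map _

/-- `1 • M = M`. [cite: BraunEtAl2016, §4.1 (p. 7)] -/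
theorem mapEdges_one (M : Finset (KnEdge n)) : mapEdges 1 M = M := by
  ext e
  rw [mem_mapEdges]
  have h1 : ∀ f : KnEdge n, edgeMap (⇑(1 : Equiv.Perm (Fin n))) (1 : Equiv.Perm (Fin n)).injective f = f :=
    fun f => Subtype.ext (by simp [edgeMap])
  constructor
  · rintro ⟨f, hf, rfl⟩; rw [h1]; exact hf
  · intro he; exact ⟨e, he, h1 e⟩

/-- `(στ) • M = σ • (τ • M)`. [cite: BraunEtAl2016, §4.1 (p. 7)] -/
theorem mapEdges_mul (σ τ : Equiv.Perm (Fin n)) (M : Finset (KnEdge n)) :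
    mapEdges (σ * τ) M = mapEdges σ (mapEdges τ M) := by
  ext e
  simp only [mem_mapEdges]
  have h : ∀ f : KnEdge n, edgeMap (⇑(σ * τ)) (σ * τ).injective f =
      edgeMap σ σ.injective (edgeMap τ τ.injective f) :=
    fun f => Subtype.ext (by simp [edgeMap, Equiv.Perm.coe_mul, Sym2.map_map])
  constructor
  · rintro ⟨f, hf, rfl⟩; exact ⟨_, ⟨f, hf, rfl⟩, (h f).symm⟩
  · rintro ⟨g, ⟨f, hf, rfl⟩, rfl⟩; exact ⟨f, hf, h f⟩

/-- `mapEdges` commutes with `insert`. [cite: BraunEtAl2016, §4.1 (p. 7)] -/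
theorem mapEdges_insert (σ : Equiv.Perm (Fin n)) (e : KnEdge n) (M : Finset (KnEdge n)) :
    mapEdges σ (insert e M) = insert (edgeMap σ σ.injective e) (mapEdges σ M) := by
  rw [mapEdges, map_insert]; rfl

/-- Vertices of `σ • M` are `σ`(vertices of `M`). [cite: BraunEtAl2016, §4.1 (p. 7)] -/
theorem mem_verts_mapEdges {σ : Equiv.Perm (Fin n)} {M : Finset (KnEdge n)} {v : Fin n} :
    v ∈ verts (mapEdges σ M) ↔ σ.symm v ∈ verts M := by
  simp only [mem_verts, mem_mapEdges]
  constructor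
  · rintro ⟨_, ⟨f, hf, rfl⟩, hv⟩
    rw [coe_edgeMap, Sym2.mem_map] at hv
    obtain ⟨w, hw, hwv⟩ := hv
    refine ⟨f, hf, ?_⟩
    rw [← hwv, Equiv.symm_apply_apply]; exact hw
  · rintro ⟨f, hf, hv⟩
    refine ⟨_, ⟨f, hf, rfl⟩, ?_⟩
    rw [coe_edgeMap, Sym2.mem_map]
    exact ⟨σ.symm v, hv, Equiv.apply_symm_apply _ _⟩

/-- Partial matchings go to partial matchings. [cite: BraunEtAl2016, §4.1 (p. 7)] -/
theorem IsPartialMatching.mapEdges {M : Finset (KnEdge n)} (hM : IsPartialMatching M) (σ : Equiv.Perm (Fin n)) :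
    IsPartialMatching (mapEdges σ M) := by
  intro e he f hf hef v ⟨hve, hvf⟩
  obtain ⟨e', he', rfl⟩ := mem_mapEdges.1 he
  obtain ⟨f', hf', rfl⟩ := mem_mapEdges.1 hf
  rw [coe_edgeMap, Sym2.mem_map] at hve hvf
  obtain ⟨w, hw, hwv⟩ := hve
  obtain ⟨w', hw', hw'v⟩ := hvf
  have hww' : w = w' := σ.injective (hwv.trans hw'v.symm)
  subst hww'
  exact hM e' he' f' hf' (fun h => hef (h ▸ rfl)) w ⟨hw, hw'⟩

/-- The action on `PMk`. [cite: BraunEtAl2016, §4.1 (p. 7)] -/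
theorem mapEdges_mem_PMk {k : ℕ} {σ : Equiv.Perm (Fin n)} {M : Finset (KnEdge n)} (hM : M ∈ PMk n k) :
    mapEdges σ M ∈ PMk n k := by
  rw [mem_PMk] at hM ⊢
  exact ⟨hM.1.mapEdges σ, by rw [card_mapEdges, hM.2]⟩

/-- **`σ(x_M) = x_{σM}`.** [cite: BraunEtAl2016, Lemma 4.7 (proof, "σ x_M")] -/
theorem polyPerm_xM (σ : Equiv.Perm (Fin n)) (M : Finset (KnEdge n)) :
    polyPerm σ (xM M) = xM (mapEdges σ M) := by
  rw [xM, xM, map_prod, mapEdges, prod_map]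
  simp only [polyPerm_X, Function.Embedding.coeFn_mk]

/-! ### Transitivity of `S_n` on `k`-matchings -/

/-- Every edge is `{p, q}` with `p ≠ q`. [cite: BraunEtAl2016, §4.2 (p. 7)] -/
theorem exists_coe_eq_mk (e : KnEdge n) : ∃ p q : Fin n, p ≠ q ∧ (e : Sym2 (Fin n)) = s(p, q) := by
  obtain ⟨s, hs⟩ := e
  induction s using Sym2.ind with
  | _ p q => exact ⟨p, q, fun h => hs (Sym2.mk_isDiag_iff.2 h), rfl⟩

/-- A permutation fixing the vertices of `M` fixes `M` edgewise. [cite: BraunEtAl2016, Lemma 4.1 (p. 7, "we set σ to the identity on S")] -/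
theorem mapEdges_eq_self_of_fix {σ : Equiv.Perm (Fin n)} {M : Finset (KnEdge n)}
    (h : ∀ v ∈ verts M, σ v = v) : mapEdges σ M = M := by
  have key : ∀ f ∈ M, edgeMap σ σ.injective f = f := by
    intro f hf
    apply Subtype.ext
    rw [coe_edgeMap]
    obtain ⟨s, hs⟩ := f
    induction s using Sym2.ind with
    | _ a b =>
      change Sym2.map σ s(a, b) = s(a, b)
      rw [Sym2.map_mk, h a (mem_verts.2 ⟨_, hf, Sym2.mem_mk_left a b⟩),
        h b (mem_verts.2 ⟨_, hf, Sym2.mem_mk_right a b⟩)]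
  ext e
  rw [mem_mapEdges]
  constructor
  · rintro ⟨f, hf, rfl⟩; rw [key f hf]; exact hf
  · intro he; exact ⟨e, he, key e he⟩

/-- Moving one free edge onto another while fixing a vertex set pointwise: for `p ≠ q`, `p' ≠ q'`
all outside `S`, some permutation fixing `S` maps `{p,q}` to `{p',q'}`.
[cite: BraunEtAl2016, Lemma 4.1 (proof, extending σ edge by edge)] -/
theorem exists_perm_fix_map_pair (S : Finset (Fin n)) {p q p' q' : Fin n} (hpq : p ≠ q) (hpq' : p' ≠ q')
    (hp : p ∉ S) (hq : q ∉ S) (hp' : p' ∉ S) (hq' : q' ∉ S) :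
    ∃ τ : Equiv.Perm (Fin n), (∀ v ∈ S, τ v = v) ∧ Sym2.map τ s(p, q) = s(p', q') := by
  classical
  -- `τ = swap q₁ q' ∘ swap p p'` with `q₁ = swap p p' q`
  set q₁ := Equiv.swap p p' q with hq₁
  have hq₁p' : q₁ ≠ p' := by
    rw [hq₁, Equiv.swap_apply_def]
    split_ifs with h1 h2
    · exact absurd h1 hpq.symm
    · intro h; exact hpq (by rw [h2, h])
    · exact h2
  have hq₁S : q₁ ∉ S := by
    rw [hq₁, Equiv.swap_apply_def]
    split_ifs <;> assumption
  refine ⟨Equiv.swap q₁ q' * Equiv.swap p p', fun v hv => ?_, ?_⟩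
  · have hvp : v ≠ p := fun h => hp (h ▸ hv)
    have hvp' : v ≠ p' := fun h => hp' (h ▸ hv)
    have hvq₁ : v ≠ q₁ := fun h => hq₁S (h ▸ hv)
    have hvq' : v ≠ q' := fun h => hq' (h ▸ hv)
    rw [Equiv.Perm.coe_mul, Function.comp_apply, Equiv.swap_apply_of_ne_of_ne hvp hvp',
      Equiv.swap_apply_of_ne_of_ne hvq₁ hvq']
  · rw [Sym2.map_mk, Equiv.Perm.coe_mul, Function.comp_apply, Function.comp_apply,
      Equiv.swap_apply_left, Equiv.swap_apply_of_ne_of_ne hq₁p'.symm hpq', ← hq₁, Equiv.swap_apply_left]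

/-- **Transitivity**: any two partial matchings of `K_n` with the same number of edges are related
by a vertex permutation. [cite: BraunEtAl2016, Lemma 4.1 (p. 7) and Lemma 4.7 (proof, orbit of x_M)] -/
theorem exists_perm_mapEdges_eq : ∀ (k : ℕ) {M M' : Finset (KnEdge n)},
    M ∈ PMk n k → M' ∈ PMk n k → ∃ σ : Equiv.Perm (Fin n), mapEdges σ M = M' := by
  classical
  intro k
  induction k with
  | zero =>
    intro M M' hM hM'
    rw [mem_PMk, card_eq_zero] at hM hM'
    rw [hM.2, hM'.2]
    exact ⟨1, mapEdges_one ∅⟩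
  | succ k ih =>
    intro M M' hM hM'
    obtain ⟨hpm, hcard⟩ := mem_PMk.1 hM
    obtain ⟨hpm', hcard'⟩ := mem_PMk.1 hM'
    obtain ⟨e, he⟩ : M.Nonempty := card_pos.1 (by omega)
    obtain ⟨e', he'⟩ : M'.Nonempty := card_pos.1 (by omega)
    have hM₀ : M.erase e ∈ PMk n k := mem_PMk.2 ⟨hpm.erase e, by rw [card_erase_of_mem he, hcard]; rfl⟩
    have hM₀' : M'.erase e' ∈ PMk n k := mem_PMk.2 ⟨hpm'.erase e', by rw [card_erase_of_mem he', hcard']; rfl⟩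
    obtain ⟨σ₀, hσ₀⟩ := ih hM₀ hM₀'
    -- the image of `e` is free for `M'.erase e'`, as is `e'`
    have hfree : edgeMap σ₀ σ₀.injective e ∈ freeEdges (M'.erase e') := by
      rw [← hσ₀, mem_freeEdges]
      intro v hv hve
      rw [mem_verts_mapEdges] at hv
      rw [coe_edgeMap, Sym2.mem_map] at hve
      obtain ⟨w, hw, hwv⟩ := hve
      have : σ₀.symm v = w := by rw [← hwv, Equiv.symm_apply_apply]
      rw [this] at hv
      exact mem_freeEdges.1 (mem_freeEdges_erase hpm he) w hv hw
    have hfree' : e' ∈ freeEdges (M'.erase e') := mem_freeEdges_erase hpm' he'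
    -- write both free edges as pairs and move one onto the other fixing `V(M'.erase e')`
    obtain ⟨p, q, hpq, hf⟩ := exists_coe_eq_mk (edgeMap σ₀ σ₀.injective e)
    obtain ⟨p', q', hpq', hf'⟩ := exists_coe_eq_mk e'
    have hfr := mem_freeEdges.1 hfree
    have hfr' := mem_freeEdges.1 hfree'
    rw [hf] at hfr
    rw [hf'] at hfr'
    obtain ⟨τ, hτS, hτe⟩ := exists_perm_fix_map_pair (verts (M'.erase e')) hpq hpq'
      (fun h => hfr p h (Sym2.mem_mk_left p q)) (fun h => hfr q h (Sym2.mem_mk_right p q))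
      (fun h => hfr' p' h (Sym2.mem_mk_left p' q')) (fun h => hfr' q' h (Sym2.mem_mk_right p' q'))
    refine ⟨τ * σ₀, ?_⟩
    rw [mapEdges_mul, ← insert_erase he, mapEdges_insert, mapEdges_insert, hσ₀,
      mapEdges_eq_self_of_fix hτS]
    conv_rhs => rw [← insert_erase he']
    congr 1
    apply Subtype.ext
    rw [coe_edgeMap, hf, hτe, hf']

/-! ### Orbit sums of matching monomials -/

/-- **The orbit sum of `x_M` is a multiple of the level sum**: `Σ_σ σ(x_M) = N_M · T_{|M|}`
(`N_M` = the common size of the fibres `{σ : σM = M'}`, `M'` a `|M|`-matching).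
[cite: BraunEtAl2016, Lemma 4.7 (proof, "Σ_σ σ x_M = 2^k k!(n-2k)! Σ_{|M'|=k} x_{M'}")] -/
theorem sum_polyPerm_xM {k : ℕ} {M : Finset (KnEdge n)} (hM : M ∈ PMk n k) :
    ∃ N : ℕ, ∑ σ : Equiv.Perm (Fin n), polyPerm σ (xM M) = (N : ℝ) • levelSum n k := by
  classical
  -- fibre decomposition over `PMk n k`
  have hfib := (sum_fiberwise_of_maps_to (s := (univ : Finset (Equiv.Perm (Fin n)))) (t := PMk n k)
    (g := fun σ => mapEdges σ M) (fun σ _ => mapEdges_mem_PMk hM) (fun σ => xM (mapEdges σ M))).symm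
  simp_rw [polyPerm_xM]
  -- all fibres have the size of the stabilizer
  let N := (univ.filter fun σ : Equiv.Perm (Fin n) => mapEdges σ M = M).card
  refine ⟨N, ?_⟩
  rw [hfib, levelSum, smul_sum]
  refine sum_congr rfl fun M' hM' => ?_
  have hinner : ∑ σ ∈ univ.filter (fun σ : Equiv.Perm (Fin n) => mapEdges σ M = M'), xM (mapEdges σ M) =
      ∑ σ ∈ univ.filter (fun σ : Equiv.Perm (Fin n) => mapEdges σ M = M'), xM M' :=
    sum_congr rfl fun σ hσ => by rw [(mem_filter.1 hσ).2]
  rw [hinner, sum_const, ← Nat.cast_smul_eq_nsmul ℝ]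
  congr 1
  -- `|{σ : σM = M'}| = |{σ : σM = M}|` via `σ ↦ τ σ` for a fixed `τ` with `τM = M'`
  obtain ⟨τ, hτ⟩ := exists_perm_mapEdges_eq k hM hM'
  norm_cast
  refine card_bij' (fun σ _ => τ⁻¹ * σ) (fun σ _ => τ * σ) ?_ ?_ ?_ ?_
  · intro σ hσ
    refine mem_filter.2 ⟨mem_univ _, ?_⟩
    rw [mapEdges_mul, (mem_filter.1 hσ).2, ← hτ, ← mapEdges_mul, inv_mul_cancel, mapEdges_one]
  · intro σ hσ
    refine mem_filter.2 ⟨mem_univ _, ?_⟩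
    rw [mapEdges_mul, (mem_filter.1 hσ).2, hτ]
  · intro σ _; rw [← mul_assoc, mul_inv_cancel, one_mul]
  · intro σ _; rw [← mul_assoc, inv_mul_cancel, one_mul]

/-- **Lemma 4.4, explicit normal form**: `F ≅_{deg F} Σ_α [supp α matching] c_α x_{supp α}`.
[cite: BraunEtAl2016, Lemma 4.4 (p. 8)] -/
theorem isCong_normalForm (F : MvPolynomial (KnEdge n) ℝ) :
    IsCong (system n) F.totalDegree F
      (∑ α ∈ F.support, if IsPartialMatching α.support then coeff α F • xM α.support else 0) := by
  classical
  conv_lhs => rw [F.as_sum]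
  refine IsCong.sum fun α hα => ?_
  have hdegα : (α.sum fun _ k => k) ≤ F.totalDegree := le_totalDegree hα
  have hmono : IsCong (system n) F.totalDegree (monomial α (coeff α F)) (coeff α F • xM α.support) := by
    have := (isCong_monomial α).smul (coeff α F)
    rw [smul_monomial, smul_eq_mul, mul_one] at this
    exact this.mono hdegα
  split_ifs with h
  · exact hmono
  · refine hmono.trans ?_
    have := (isCong_xM_zero h).smul (coeff α F)
    rw [smul_zero] at this
    exact this.mono ((card_support_le_degree α).trans hdegα)

/-- **BBCHPRRWZ Lemma 4.7 (symmetrization).** For every polynomial `F` in the edge variables of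
`K_n` there is a constant `c` with `Σ_{σ ∈ S_n} σF ≅_{(𝒫_n, deg F)} c`.
[cite: BraunEtAl2016, Lemma 4.7 (p. 8)] -/
theorem symmetrizationConstant (F : MvPolynomial (KnEdge n) ℝ) :
    ∃ c : ℝ, IsCong (system n) F.totalDegree (∑ σ : Equiv.Perm (Fin n), polyPerm σ F) (C c) := by
  classical
  -- the terms of the normal form
  set T : (KnEdge n →₀ ℕ) → MvPolynomial (KnEdge n) ℝ :=
    fun α => if IsPartialMatching α.support then coeff α F • xM α.support else 0 with hT
  -- reduce to the normal form
  have hNF : IsCong (system n) F.totalDegree F (∑ α ∈ F.support, T α) := isCong_normalForm F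
  have hsymm : IsCong (system n) F.totalDegree (∑ σ : Equiv.Perm (Fin n), polyPerm σ F)
      (∑ σ : Equiv.Perm (Fin n), polyPerm σ (∑ α ∈ F.support, T α)) :=
    IsCong.sum fun σ _ => hNF.perm σ
  have hswap : (∑ σ : Equiv.Perm (Fin n), polyPerm σ (∑ α ∈ F.support, T α)) =
      ∑ α ∈ F.support, ∑ σ : Equiv.Perm (Fin n), polyPerm σ (T α) := by
    rw [sum_comm]
    exact sum_congr rfl fun σ _ => map_sum _ _ _
  rw [hswap] at hsymm
  -- each orbit sum of a matching monomial is a constant modulo `𝒫_n` in degree `|supp α| ≤ deg F`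
  have hterm : ∀ α ∈ F.support, ∃ c : ℝ,
      IsCong (system n) F.totalDegree (∑ σ : Equiv.Perm (Fin n), polyPerm σ (T α)) (C c) := by
    intro α hα
    by_cases h : IsPartialMatching α.support
    · have hTα : T α = coeff α F • xM α.support := if_pos h
      have hk : α.support ∈ PMk n α.support.card := mem_PMk.2 ⟨h, rfl⟩
      obtain ⟨N, hN⟩ := sum_polyPerm_xM hk
      have h1 : (∑ σ : Equiv.Perm (Fin n), polyPerm σ (T α)) =
          (coeff α F * (N : ℝ)) • levelSum n α.support.card := by
        rw [hTα]
        simp_rw [map_smul]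
        rw [← smul_sum, hN, smul_smul]
      rw [h1]
      refine ⟨coeff α F * (N : ℝ) * levelConst n α.support.card, ?_⟩
      have h2 := (levelSum_isCong_C (n := n) α.support.card).smul (coeff α F * (N : ℝ))
      have h3 : (coeff α F * (N : ℝ)) • (C (levelConst n α.support.card) : MvPolynomial (KnEdge n) ℝ) =
          C (coeff α F * (N : ℝ) * levelConst n α.support.card) := by
        rw [map_mul, smul_eq_C_mul]
      rw [h3] at h2
      exact h2.mono ((card_support_le_degree α).trans (le_totalDegree hα))
    · have hTα : T α = 0 := if_neg h
      rw [hTα]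
      simp_rw [map_zero, sum_const_zero]
      exact ⟨0, by rw [map_zero]; exact IsCong.refl _⟩
  choose c hc using hterm
  refine ⟨∑ α ∈ F.support.attach, c α.1 α.2, hsymm.trans ?_⟩
  rw [map_sum C, ← sum_attach F.support]
  exact IsCong.sum fun α _ => hc α.1 α.2

/-- The cell's typed `SymmetrizationConstant` (Sketch-v2 §2c, verbatim shape; `Even n` unused).
[cite: BraunEtAl2016, Lemma 4.7 (p. 8)] -/
theorem symmetrizationConstant' :
    ∀ n : ℕ, Even n → ∀ F : MvPolynomial (KnEdge n) ℝ, ∃ c : ℝ,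
      HasDerivationOfDegree (system n)
        ((∑ σ : Equiv.Perm (Fin n), polyPerm σ F) - MvPolynomial.C c) F.totalDegree := by
  intro n _ F
  obtain ⟨c, hc⟩ := symmetrizationConstant F
  refine ⟨c, ?_⟩
  have h := isCong_iff_hasDerivationOfDegree_sub.1 hc.symm
  exact h

end Mod2

end Literature.Computability.Complexity
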